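import Literature.MathematicalPhysics.StatisticalMechanics.BarlowRings

/-!
# Route `PricedLinkCensus`, crux `StackingHinge` (stmt-AtomisticToContinuum-14993), line `Sketch`:
# stub `stub_similarStarNormalisation` (V3), support file I — common neighbours below `√3 · a`

Pure combinatorics of the ideal Barlow stackings `barlowStacking a h s` (`a > 0`, `h² = ⅔ a²`,
`s` a Hägg word), complementing `BarlowCoordination` (twelve touching sites) and `BarlowRings`
(distance gap `(a, √2 a)`, four common neighbours of a touching pair):

* `exists_common_touching` — **two distinct sites at distance `< √3 · a` have a common touching
  site.**  With the twelve-coordination form `12 · dist² = a² · F`,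
  `F = 3(2P+Q+Λ)² + (3Q+Λ)² + 8K²`, the hypothesis is `F < 36`; then `|K| ≤ 2`, and: `K = 0`
  forces `F = 12` (touching: four common neighbours); `|K| = 1` forces the adjacent-layer form to be
  `4` (touching) or `16` (the second shell `√2 · a`), and each of the finitely many solutions has an
  in-layer neighbour of the lower site touching the upper one (`adjLayer_common`, a finite check);
  `|K| = 2` forces `P = Q = 0` (`twoLayer_eq`), and the site with the same indices in the middle
  layer touches both.

All `[folklore]`.
-/

namespace Summit.AtomisticToContinuum.Crystallization.Theorems.PricedHcpWindowsSimilarStarNormalisation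

open Literature.MathematicalPhysics.StatisticalMechanics

/-! ## Integer lemmas -/

/-- **Adjacent layers**: for a letter shift `σ = ±1`, every solution `(P, Q)` of
`3(2P+Q+σ)² + (3Q+σ)² < 28` other than the touching ones (`= 4`) — i.e. the second-shell offsets,
form `16` — admits an in-layer offset `PQ ∈ sixOffsets` with `PQ − (P, Q) ∈ threeOffsets (−σ)`
(a common touching site). [folklore] -/
theorem adjLayer_common {P Q σ : ℤ} (hσ : σ = 1 ∨ σ = -1)
    (hlt : 3 * (2 * P + Q + σ) ^ 2 + (3 * Q + σ) ^ 2 < 28)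
    (hne : 3 * (2 * P + Q + σ) ^ 2 + (3 * Q + σ) ^ 2 ≠ 4) :
    ∃ PQ ∈ sixOffsets, (PQ.1 - P, PQ.2 - Q) ∈ threeOffsets (-σ) := by
  have hv : (3 * Q + σ) ^ 2 < 6 ^ 2 := by nlinarith [sq_nonneg (2 * P + Q + σ)]
  have hu : (2 * P + Q + σ) ^ 2 < 4 ^ 2 := by nlinarith [sq_nonneg (3 * Q + σ)]
  obtain ⟨hv1, hv2⟩ := abs_lt_of_sq_lt_sq' hv (by norm_num)
  obtain ⟨hu1, hu2⟩ := abs_lt_of_sq_lt_sq' hu (by norm_num)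
  rcases hσ with rfl | rfl
  · have hQ1 : -2 ≤ Q := by omega
    have hQ2 : Q ≤ 1 := by omega
    have hP1 : -3 ≤ P := by omega
    have hP2 : P ≤ 3 := by omega
    interval_cases P <;> interval_cases Q <;> first | (exfalso; omega) | decide
  · have hQ1 : -1 ≤ Q := by omega
    have hQ2 : Q ≤ 2 := by omega
    have hP1 : -3 ≤ P := by omega
    have hP2 : P ≤ 3 := by omega
    interval_cases P <;> interval_cases Q <;> first | (exfalso; omega) | decide

/-- **Same layer**: `3(2P+Q)² + (3Q)² < 36` forces `(P, Q) = 0` or the touching value `12`.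
[folklore] -/
theorem inLayer_lt {P Q : ℤ} (hlt : 3 * (2 * P + Q) ^ 2 + (3 * Q) ^ 2 < 36) :
    (P = 0 ∧ Q = 0) ∨ 3 * (2 * P + Q) ^ 2 + (3 * Q) ^ 2 = 12 := by
  have hQ : Q ^ 2 < 2 ^ 2 := by nlinarith [sq_nonneg (2 * P + Q)]
  have hP : P ^ 2 < 2 ^ 2 := by nlinarith [sq_nonneg (2 * Q + P)]
  obtain ⟨hQ1, hQ2⟩ := abs_lt_of_sq_lt_sq' hQ (by norm_num)
  obtain ⟨hP1, hP2⟩ := abs_lt_of_sq_lt_sq' hP (by norm_num)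
  interval_cases P <;> interval_cases Q <;> omega

/-- **Two layers apart**: with `Λ ∈ {−2, 0, 2}`, `3(2P+Q+Λ)² + (3Q+Λ)² + 32 < 36` forces
`P = Q = 0`. [folklore] -/
theorem twoLayer_eq {P Q Λ : ℤ} (hΛ : Λ = -2 ∨ Λ = 0 ∨ Λ = 2)
    (hlt : 3 * (2 * P + Q + Λ) ^ 2 + (3 * Q + Λ) ^ 2 + 32 < 36) : P = 0 ∧ Q = 0 := by
  have hv : (3 * Q + Λ) ^ 2 < 2 ^ 2 := by nlinarith [sq_nonneg (2 * P + Q + Λ)]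
  have hu : (2 * P + Q + Λ) ^ 2 < 2 ^ 2 := by nlinarith [sq_nonneg (3 * Q + Λ)]
  obtain ⟨hv1, hv2⟩ := abs_lt_of_sq_lt_sq' hv (by norm_num)
  obtain ⟨hu1, hu2⟩ := abs_lt_of_sq_lt_sq' hu (by norm_num)
  rcases hΛ with rfl | rfl | rfl
  · have hQ : Q = 1 := by omega
    subst hQ
    have hP1 : 0 ≤ P := by omega
    have hP2 : P ≤ 1 := by omega
    interval_cases P <;> omega
  · constructor <;> omega
  · have hQ : Q = -1 := by omega
    subst hQ
    have hP1 : -1 ≤ P := by omega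
    have hP2 : P ≤ 0 := by omega
    interval_cases P <;> omega

/-! ## Common touching sites -/

section Ideal

variable {a h : ℝ} {s : ℤ → ℤ}

/-- **Adjacent layers**: if the adjacent-layer form of `barlowPos k i j` and `barlowPos (k+1) i' j'`
is `< 28` and `≠ 4`, the two sites have a common touching site (an in-layer neighbour of the lower
one). [folklore] -/
theorem exists_common_touching_succ (hs : IsHaggSeq s) (ha : 0 < a) (hh : h ^ 2 = 2 / 3 * a ^ 2)
    {k i j i' j' : ℤ}
    (hlt : 3 * (2 * (i - i') + (j - j') + -s k) ^ 2 + (3 * (j - j') + -s k) ^ 2 < 28)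
    (hne : 3 * (2 * (i - i') + (j - j') + -s k) ^ 2 + (3 * (j - j') + -s k) ^ 2 ≠ 4) :
    ∃ v ∈ barlowStacking a h s, dist (barlowPos a h s k i j) v = a ∧
      dist (barlowPos a h s (k + 1) i' j') v = a := by
  have hσ : -s k = 1 ∨ -s k = -1 := by rcases hs k with h1 | h1 <;> omega
  obtain ⟨PQ, hPQ, hPQ'⟩ := adjLayer_common hσ hlt hne
  rw [neg_neg] at hPQ'
  refine ⟨barlowPos a h s k (i - PQ.1) (j - PQ.2), barlowPos_mem _ _ _, ?_, ?_⟩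
  · rw [dist_barlowPos_eq_iff hs ha hh]
    refine Or.inl ⟨rfl, ?_⟩
    simpa using hPQ
  · rw [dist_barlowPos_eq_iff hs ha hh]
    refine Or.inr (Or.inr ⟨by ring, ?_⟩)
    have e1 : i' - (i - PQ.1) = PQ.1 - (i - i') := by ring
    have e2 : j' - (j - PQ.2) = PQ.2 - (j - j') := by ring
    have e3 : k + 1 - 1 = k := by ring
    rw [e1, e2, e3]
    exact hPQ'

/-- **Two layers apart, same indices**: `barlowPos k i j` and `barlowPos (k+2) i j` both touch
`barlowPos (k+1) i j` (the offset `(0, 0)` is a touching offset for either letter). [folklore] -/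
theorem exists_common_touching_two (hs : IsHaggSeq s) (ha : 0 < a) (hh : h ^ 2 = 2 / 3 * a ^ 2)
    (k i j : ℤ) :
    ∃ v ∈ barlowStacking a h s, dist (barlowPos a h s k i j) v = a ∧
      dist (barlowPos a h s (k + 2) i j) v = a := by
  have h00 : ∀ σ : ℤ, ((0 : ℤ), (0 : ℤ)) ∈ threeOffsets σ := by
    intro σ
    unfold threeOffsets
    split_ifs <;> decide
  refine ⟨barlowPos a h s (k + 1) i j, barlowPos_mem _ _ _, ?_, ?_⟩
  · rw [dist_barlowPos_eq_iff hs ha hh]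
    refine Or.inr (Or.inl ⟨rfl, ?_⟩)
    simpa using h00 (-s k)
  · rw [dist_barlowPos_eq_iff hs ha hh]
    refine Or.inr (Or.inr ⟨by ring, ?_⟩)
    simpa using h00 (s (k + 2 - 1))

/-- **Two distinct sites of an ideal Barlow stacking at distance `< √3 · a` have a common touching
site** (for touching pairs: one of the four common neighbours, `ncard_commonTouching_eq_four`; for
the second shell `√2 · a` across adjacent layers and the axial pair `√(8/3) · a` two layers apart:
the finite checks above). [folklore] -/
theorem exists_common_touching (hs : IsHaggSeq s) (ha : 0 < a) (hh : h ^ 2 = 2 / 3 * a ^ 2)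
    {u w : EuclideanSpace ℝ (Fin 3)} (hu : u ∈ barlowStacking a h s)
    (hw : w ∈ barlowStacking a h s) (hne : u ≠ w) (hlt : dist u w < Real.sqrt 3 * a) :
    ∃ v ∈ barlowStacking a h s, dist u v = a ∧ dist w v = a := by
  -- touching pairs have four common neighbours
  by_cases htouch : dist u w = a
  · have h4 := ncard_commonTouching_eq_four hs ha hh hu hw htouch
    obtain ⟨v, hv⟩ := Set.nonempty_of_ncard_ne_zero
      (s := {v | v ∈ barlowStacking a h s ∧ dist u v = a ∧ dist w v = a}) (by rw [h4]; norm_num)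
    exact ⟨v, hv.1, hv.2.1, hv.2.2⟩
  obtain ⟨k, i, j, rfl⟩ := hu
  obtain ⟨k', i', j', rfl⟩ := hw
  -- the twelve-coordination form is `< 36` and `≠ 12`
  have h12 := twelve_mul_dist_barlowPos_sq hh s k i j k' i' j'
  set Λ : ℤ := haggLabel s k - haggLabel s k' with hΛ
  have hF36 : 3 * (2 * (i - i') + (j - j') + Λ) ^ 2 + (3 * (j - j') + Λ) ^ 2 + 8 * (k - k') ^ 2 <
      36 := by
    have hd0 : 0 ≤ dist (barlowPos a h s k i j) (barlowPos a h s k' i' j') := dist_nonneg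
    have hsq : dist (barlowPos a h s k i j) (barlowPos a h s k' i' j') ^ 2 < 3 * a ^ 2 := by
      have h3 : Real.sqrt 3 ^ 2 = 3 := Real.sq_sqrt (by norm_num)
      have hsa : 0 ≤ Real.sqrt 3 * a := by positivity
      nlinarith [mul_self_lt_mul_self hd0 hlt]
    have ha2 : 0 < a ^ 2 := by positivity
    have hF' : ((3 * (2 * (i - i') + (j - j') + Λ) ^ 2 + (3 * (j - j') + Λ) ^ 2 +
        8 * (k - k') ^ 2 : ℤ) : ℝ) < 36 := by
      by_contra hge
      push Not at hge
      nlinarith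
    exact_mod_cast hF'
  have hF12 : 3 * (2 * (i - i') + (j - j') + Λ) ^ 2 + (3 * (j - j') + Λ) ^ 2 + 8 * (k - k') ^ 2 ≠
      12 := fun hF => htouch ((dist_barlowPos_eq_iff_form ha hh s k i j k' i' j').2 hF)
  -- hence `|k - k'| ≤ 2`
  have hK : (k - k') ^ 2 < 3 ^ 2 := by
    nlinarith [sq_nonneg (2 * (i - i') + (j - j') + Λ), sq_nonneg (3 * (j - j') + Λ)]
  obtain ⟨hK1, hK2⟩ := abs_lt_of_sq_lt_sq' hK (by norm_num)
  rcases (show k' = k ∨ k' = k + 1 ∨ k' = k + 2 ∨ k = k' + 1 ∨ k = k' + 2 by omega) with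
    hk' | hk' | hk' | hk' | hk'
  · -- same layer: impossible
    exfalso
    have hΛ0 : Λ = 0 := by rw [hΛ, hk', sub_self]
    have e8 : 8 * (k - k') ^ 2 = 0 := by rw [hk']; ring
    rw [hΛ0, e8, add_zero, add_zero, add_zero] at hF36 hF12
    rcases inLayer_lt hF36 with ⟨hP, hQ⟩ | h12'
    · apply hne
      rw [hk', show i = i' by omega, show j = j' by omega]
    · exact hF12 h12'
  · -- `w` one layer up
    subst hk'
    have hΛ' : Λ = -s k := by rw [hΛ, haggLabel_sub_haggLabel_succ]
    have e8 : 8 * (k - (k + 1)) ^ 2 = 8 := by ring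
    rw [hΛ', e8] at hF36 hF12
    exact exists_common_touching_succ hs ha hh (by linarith) (fun h4 => hF12 (by linarith))
  · -- `w` two layers up
    subst hk'
    have hΛ' : Λ = -(s k + s (k + 1)) := by
      rw [hΛ, show k + 2 = k + 1 + 1 by ring, haggLabel_succ, haggLabel_succ]; ring
    have hΛ3 : Λ = -2 ∨ Λ = 0 ∨ Λ = 2 := by
      rcases hs k with h1 | h1 <;> rcases hs (k + 1) with h2 | h2 <;> omega
    have e8 : 8 * (k - (k + 2)) ^ 2 = 32 := by ring
    rw [e8] at hF36
    obtain ⟨hP, hQ⟩ := twoLayer_eq hΛ3 hF36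
    rw [show i' = i by omega, show j' = j by omega]
    exact exists_common_touching_two hs ha hh k i j
  · -- `u` one layer up: swap the roles
    subst hk'
    have hΛ' : Λ = s k' := by rw [hΛ, haggLabel_succ]; ring
    have e8 : 8 * (k' + 1 - k') ^ 2 = 8 := by ring
    rw [hΛ', e8] at hF36 hF12
    have hsym : 3 * (2 * (i' - i) + (j' - j) + -s k') ^ 2 + (3 * (j' - j) + -s k') ^ 2 =
        3 * (2 * (i - i') + (j - j') + s k') ^ 2 + (3 * (j - j') + s k') ^ 2 := by ring
    obtain ⟨v, hv, h1, h2⟩ := exists_common_touching_succ hs ha hh (k := k') (i := i') (j := j')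
      (i' := i) (j' := j) (by rw [hsym]; linarith) (fun h4 => hF12 (by rw [hsym] at h4; linarith))
    exact ⟨v, hv, h2, h1⟩
  · -- `u` two layers up: swap the roles
    subst hk'
    have hΛ' : Λ = s k' + s (k' + 1) := by
      rw [hΛ, show k' + 2 = k' + 1 + 1 by ring, haggLabel_succ, haggLabel_succ]; ring
    have hΛ3 : Λ = -2 ∨ Λ = 0 ∨ Λ = 2 := by
      rcases hs k' with h1 | h1 <;> rcases hs (k' + 1) with h2 | h2 <;> omega
    have e8 : 8 * (k' + 2 - k') ^ 2 = 32 := by ring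
    rw [e8] at hF36
    obtain ⟨hP, hQ⟩ := twoLayer_eq hΛ3 hF36
    rw [show i = i' by omega, show j = j' by omega]
    obtain ⟨v, hv, h1, h2⟩ := exists_common_touching_two hs ha hh k' i' j'
    exact ⟨v, hv, h2, h1⟩

end Ideal

end Summit.AtomisticToContinuum.Crystallization.Theorems.PricedHcpWindowsSimilarStarNormalisation
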